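import Mathlib
import Literature.NumberTheory.NumberFields.PureCubicClassNumberModThreeProofs
import Literature.NumberTheory.NumberFields.PureCubicGenusDivisorLemmas
import Literature.NumberTheory.NumberFields.UnramifiedCyclicOddDegreeArtinMap
import HarnessLib

/-!
# `p ≡ −1 (mod 9)`: the unramified Kummer extension `L(∛p)/L` of `L = ℚ(ζ₃, ∛(pq))` and `3 ∣ h(L)`

Route `LinnikCubicClassGroups` (rank-0 hypothesis-type target `PureCubicClassNumberHard`,
stmt-QuantumAdvantage-11826): the genus-theoretic half of Honda's criterion (Honda 1971, Theorem)
in the case `p ≡ q ≡ 8 (mod 9)`, over the sextic field `L = K(ζ₃)`: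

* `pow_three_ne_natCast_of_ramified` — `X³ − p` has no root in `L`: a root in `F = ℚ(ζ₃)` would
  make `p²` a rational cube; a root outside `F` would make `L = F(∛p)` unramified at the prime
  above `q`, which is totally ramified;
* `three_dvd_classNumber_of_cubeRoot_unramified` — **`3 ∣ h(L)`**: `E = L(∛p) = L(∛q)` is a cyclic
  cubic extension unramified at every finite prime (tame primes by the different `∋ 3∛p², 3∛q²`;
  primes above `3` by Hecke's criterion, since `−p = 1 + λ³w`, `λ = 2ζ₃ + 1`), so the tree's Artin
  map for unramified cyclic extensions of odd prime degree applies.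

HONEST FRAMING (block-2b rule): kernel-checked classical algebraic number theory (Honda 1971), an
independent certification, NOT summit progress; the crux `PureCubicClassNumberHard` is
hypothesis-type and untouched.

## References
* T. Honda, *Pure cubic fields whose class numbers are multiples of three*, J. Number Theory 3
  (1971) 7–12, Theorem. [Honda1971]
* S. Aouissi, D. C. Mayer, M. C. Ismaili, M. Talbi, A. Azizi, *3-rank of ambiguous class groups of
  cubic Kummer extensions*, Period. Math. Hungar. 81 (2020), Thm. 2.3. [AouissiMayerIsmailiTalbiAzizi2020]
* E. Hecke, *Lectures on the Theory of Algebraic Numbers*, GTM 77 (1981), §39 Thm. 119. [Hecke1981]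
-/

set_option linter.dupNamespace false

noncomputable section

open NumberField Polynomial IsDedekindDomain

open scoped Pointwise NumberField nonZeroDivisors IntermediateField

namespace Summit.QuantumAdvantage.QuantumAdvantage.Theorems.LinnikCubicClassGroups

open Literature.NumberTheory.NumberFields

/-! ### `X³ − p` stays irreducible over `L = ℚ(ζ₃, ∛(pq))` -/

/-- **No cube root of `p` in `L ⊇ F = ℚ(ζ₃)`** when a prime `P ∋ q` (`q ≠ p, 3` prime) of `L` is
totally ramified over `F` (`[L : F] = 3`): if `b³ = p` with `b ∈ F` then `N_{F/ℚ}(b)³ = p²` is a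
rational cube; if `b ∉ F` then `L = F(b) = F(∛p)` is unramified at `P ∌ 3p`
(`isUnramifiedAt_of_cube_eq`), contradicting `e(P|F) = 3`. [folklore] -/
theorem pow_three_ne_natCast_of_ramified {L : Type*} [Field L] [NumberField L]
    (F : IntermediateField ℚ L) (hF2 : Module.finrank ℚ F = 2) (hFL : Module.finrank F L = 3)
    {p q : ℕ} (hp : p.Prime) (hq : q.Prime) (hpq : p ≠ q) (hq3 : q ≠ 3)
    {P : Ideal (𝓞 L)} [hP : P.IsMaximal] (hqP : (q : 𝓞 L) ∈ P)
    (he : P.ramificationIdx (𝓞 F) = 3) (b : L) : b ^ 3 ≠ (p : L) := by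
  classical
  intro hb
  haveI : Fact p.Prime := ⟨hp⟩
  have hP0 : P ≠ ⊥ := Ideal.IsMaximal.ne_bot_of_isIntegral_int P
  let v : HeightOneSpectrum (𝓞 L) := ⟨P, hP.isPrime, hP0⟩
  have h3P : (3 : 𝓞 L) ∉ P := by
    have h := Honda1971.natCast_notMem_of_coprime (K := L)
      ((Nat.coprime_primes hq Nat.prime_three).mpr hq3) v hqP
    exact_mod_cast h
  have hpP : (p : 𝓞 L) ∉ P :=
    Honda1971.natCast_notMem_of_coprime (K := L) ((Nat.coprime_primes hq hp).mpr hpq.symm) v hqP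
  -- `[F(b) : F] ∈ {1, 3}`
  have hint : IsIntegral F b := IsIntegral.of_finite F b
  have htower := Module.finrank_mul_finrank F F⟮b⟯ L
  rw [hFL] at htower
  have hdvd : Module.finrank F F⟮b⟯ ∣ 3 := Dvd.intro _ htower
  rcases (Nat.dvd_prime Nat.prime_three).mp hdvd with h1 | h3
  · -- `b ∈ F`: `N(b)³ = p²` is a rational cube
    obtain ⟨f, hf⟩ := IntermediateField.mem_bot.mp
      (IntermediateField.finrank_adjoin_simple_eq_one_iff.mp h1)
    have hf3 : f ^ 3 = algebraMap ℚ F (p : ℚ) := by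
      apply (algebraMap F L).injective
      rw [map_pow, hf, hb]
      simp
    have hN : (Algebra.norm ℚ f) ^ 3 = ((p ^ 2 : ℕ) : ℚ) := by
      rw [← map_pow, hf3, Algebra.norm_algebraMap, hF2]
      push_cast
      ring
    exact Honda1971.pow_three_ne_of_not_dvd_padicValNat hp (m := p ^ 2)
      (by rw [padicValNat.prime_pow]; decide) _ hN
  · -- `L = F(b)`: then `P ∌ 3p` is unramified over `F`
    have htop : F⟮b⟯ = ⊤ :=
      IntermediateField.eq_of_le_of_finrank_eq le_top
        (by rw [h3, IntermediateField.finrank_top', hFL])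
    have hb' : b ^ 3 = algebraMap (𝓞 F) L (p : 𝓞 F) :=
      hb.trans (map_natCast (algebraMap (𝓞 F) L) p).symm
    have hpP' : algebraMap (𝓞 F) (𝓞 L) (p : 𝓞 F) ∉ P := by
      rw [map_natCast (algebraMap (𝓞 F) (𝓞 L)) p]
      exact hpP
    have hunr := Honda1971.isUnramifiedAt_of_cube_eq hb' htop P h3P hpP'
    have h1 : P.ramificationIdx (𝓞 F) = 1 := Ideal.ramificationIdx_eq_one_iff.mpr hunr
    omega

/-! ### The unramified Kummer extension `L(∛p)/L` for `p ≡ q ≡ −1 (mod 9)` -/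

/-- **`3 ∣ h(L)` from the unramified cyclic cubic extension `L(∛p)/L`.**  Let `L` be a number
field containing a primitive cube root of unity `ζ` and a cube root `θ` of `pq` (`p ≠ q` primes,
`≠ 3`), with `p ≡ −1 (mod 9)` and `X³ − p` irreducible over `L`.  Then `E = L(∛p) = L(∛q)` is a
cyclic cubic extension of `L` unramified at every finite prime: at primes `∌ 3p` by
`𝔇 ∋ 3∛p²`, at primes `∌ 3q` by `𝔇 ∋ 3∛q²` (`isUnramifiedAt_of_cube_eq`), and above `3` because
`−p = 1 + λ³w` with `λ = 2ζ + 1`, `λ² = −3` (`p + 1 = 9k`, `w = −kλ`;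
`isUnramifiedAt_of_one_add_lambda_cubed_of_three_mem`).  The tree's Artin map for unramified
cyclic extensions of odd prime degree (`dvd_classNumber_of_isUnramifiedIn_of_odd_prime_card`)
gives `3 ∣ h(L)`. [folklore] -/
theorem three_dvd_classNumber_of_cubeRoot_unramified (L : Type) [Field L] [NumberField L]
    {ζ : L} (hζ : ζ ^ 2 + ζ + 1 = 0)
    {p q : ℕ} (hp : p.Prime) (hq : q.Prime) (hpq : p ≠ q) (hp9 : p % 9 = 8)
    {θ : L} (hθ : θ ^ 3 = ((p * q : ℕ) : L)) (hirr : ∀ b : L, b ^ 3 ≠ (p : L)) :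
    3 ∣ classNumber L := by
  classical
  -- `ζ` is a primitive cube root of unity
  have hprim : IsPrimitiveRoot ζ 3 := by
    haveI : NeZero ((3 : ℕ) : L) := ⟨by norm_num⟩
    rw [← isRoot_cyclotomic_iff, cyclotomic_three, IsRoot.def]
    simp only [eval_add, eval_pow, eval_X, eval_one]
    exact hζ
  have hζne : (primitiveRoots 3 L).Nonempty := ⟨ζ, (mem_primitiveRoots (by norm_num)).mpr hprim⟩
  -- the Kummer extension `E = L(∛p)`
  have H : Irreducible (X ^ 3 - C (p : L)) := X_pow_sub_C_irreducible_of_prime Nat.prime_three hirr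
  haveI := Fact.mk H
  let E := AdjoinRoot (X ^ 3 - C (p : L))
  haveI hsf := isSplittingField_AdjoinRoot_X_pow_sub_C hζne H
  haveI : IsGalois L E := isGalois_of_isSplittingField_X_pow_sub_C hζne H E
  have hLE : Module.finrank L E = 3 := finrank_of_isSplittingField_X_pow_sub_C hζne H E
  haveI : Module.Finite L E := Polynomial.IsSplittingField.finiteDimensional E (X ^ 3 - C (p : L))
  haveI : NumberField E := NumberField.of_module_finite L E
  have hcard : Nat.card (E ≃ₐ[L] E) = 3 := by rw [IsGalois.card_aut_eq_finrank, hLE]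
  set β : E := AdjoinRoot.root (X ^ 3 - C (p : L)) with hβdef
  have hβ3 : β ^ 3 = (p : E) := by
    rw [hβdef, root_X_pow_sub_C_pow]
    exact map_natCast (AdjoinRoot.of _) p
  have hβ0 : β ≠ 0 := root_X_pow_sub_C_ne_zero (by norm_num) _
  have hgenβ : IntermediateField.adjoin L {β} = ⊤ := by
    rw [eq_top_iff]
    intro z _
    have hz : z ∈ Algebra.adjoin L {β} := by
      rw [hβdef, AdjoinRoot.adjoinRoot_eq_top]
      trivial
    exact IntermediateField.algebra_adjoin_le_adjoin L {β} hz
  -- the other generator `γ = θ/β`, `γ³ = q`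
  set γ : E := algebraMap L E θ * β⁻¹ with hγdef
  have hγ3 : γ ^ 3 = (q : E) := by
    have hp0 : (p : E) ≠ 0 := by exact_mod_cast hp.ne_zero
    have h1 : algebraMap L E ((p * q : ℕ) : L) = (p : E) * (q : E) := by
      rw [map_natCast (algebraMap L E) (p * q), Nat.cast_mul]
    rw [hγdef, mul_pow, ← map_pow, hθ, inv_pow, hβ3, h1, mul_comm (p : E) (q : E), mul_assoc,
      mul_inv_cancel₀ hp0, mul_one]
  have hgenγ : IntermediateField.adjoin L {γ} = ⊤ := by
    rw [eq_top_iff, ← hgenβ, IntermediateField.adjoin_simple_le_iff]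
    have hγmem : γ ∈ IntermediateField.adjoin L {γ} := IntermediateField.mem_adjoin_simple_self L γ
    have hθmem : algebraMap L E θ ∈ IntermediateField.adjoin L {γ} :=
      IntermediateField.algebraMap_mem _ θ
    have hγ0 : γ ≠ 0 := by
      intro h0
      rw [h0, zero_pow three_ne_zero] at hγ3
      exact hq.ne_zero (by exact_mod_cast hγ3.symm)
    have : β = algebraMap L E θ * γ⁻¹ := by
      rw [hγdef, mul_inv, inv_inv, ← mul_assoc, mul_inv_cancel₀, one_mul]
      intro hθ0
      rw [hθ0, zero_mul] at hγdef
      exact hγ0 hγdef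
    rw [this]
    exact mul_mem hθmem (inv_mem hγmem)
  -- `λ = 2ζ + 1`, `λ² = -3`, `-p = 1 + λ³ w`
  let ζO : 𝓞 L := ⟨ζ, hprim.isIntegral (by norm_num)⟩
  have hζO : (ζO : L) = ζ := rfl
  set lam : 𝓞 L := 2 * ζO + 1 with hlamdef
  have hζO3 : ζO ^ 2 + ζO + 1 = 0 := RingOfIntegers.ext (by push_cast; exact hζ)
  have hlam : lam ^ 2 = -3 := by
    rw [hlamdef]
    linear_combination 4 * hζO3
  obtain ⟨k, hk⟩ : 9 ∣ p + 1 := by omega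
  set u : 𝓞 L := -(p : 𝓞 L) with hudef
  set w : 𝓞 L := -(k : 𝓞 L) * lam with hwdef
  have hu : u = 1 + lam ^ 3 * w := by
    have hk' : ((p : 𝓞 L)) + 1 = 9 * k := by exact_mod_cast hk
    rw [hudef, hwdef]
    linear_combination (-1 : 𝓞 L) * hk' + (k : 𝓞 L) * (lam ^ 2 - 3) * hlam
  have hy : (-β) ^ 3 = algebraMap (𝓞 L) E u := by
    have h1 : algebraMap (𝓞 L) E u = -(β ^ 3) := by
      rw [hβ3, hudef, map_neg, map_natCast (algebraMap (𝓞 L) E) p]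
    rw [h1]
    ring
  have hgeny : IntermediateField.adjoin L {-β} = ⊤ := by
    rw [Honda1971.adjoin_neg_eq]
    exact hgenβ
  -- every prime of `E` is unramified over `L`
  have hunrAt : ∀ (Q : Ideal (𝓞 E)) [Q.IsMaximal], Algebra.IsUnramifiedAt (𝓞 L) Q := by
    intro Q hQ
    by_cases h3Q : (3 : 𝓞 E) ∈ Q
    · exact Honda1971.isUnramifiedAt_of_one_add_lambda_cubed_of_three_mem hlam hu hy hgeny Q h3Q
    have hQ0 : Q ≠ ⊥ := Ideal.IsMaximal.ne_bot_of_isIntegral_int Q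
    let vQ : HeightOneSpectrum (𝓞 E) := ⟨Q, hQ.isPrime, hQ0⟩
    by_cases hpQ : (p : 𝓞 E) ∈ Q
    · -- use the generator `γ`, `γ³ = q`, `q ∉ Q`
      have hqQ : (q : 𝓞 E) ∉ Q :=
        Honda1971.natCast_notMem_of_coprime (K := E) ((Nat.coprime_primes hp hq).mpr hpq) vQ hpQ
      have hγ' : γ ^ 3 = algebraMap (𝓞 L) E (q : 𝓞 L) :=
        hγ3.trans (map_natCast (algebraMap (𝓞 L) E) q).symm
      have hqQ' : algebraMap (𝓞 L) (𝓞 E) (q : 𝓞 L) ∉ Q := by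
        rw [map_natCast (algebraMap (𝓞 L) (𝓞 E)) q]
        exact hqQ
      exact Honda1971.isUnramifiedAt_of_cube_eq hγ' hgenγ Q h3Q hqQ'
    · have hβ' : β ^ 3 = algebraMap (𝓞 L) E (p : 𝓞 L) :=
        hβ3.trans (map_natCast (algebraMap (𝓞 L) E) p).symm
      have hpQ' : algebraMap (𝓞 L) (𝓞 E) (p : 𝓞 L) ∉ Q := by
        rw [map_natCast (algebraMap (𝓞 L) (𝓞 E)) p]
        exact hpQ
      exact Honda1971.isUnramifiedAt_of_cube_eq hβ' hgenβ Q h3Q hpQ'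
  have hunr : ∀ v : HeightOneSpectrum (𝓞 L), Algebra.IsUnramifiedIn (𝓞 E) v.asIdeal := by
    intro v
    refine Algebra.isUnramifiedIn_iff_forall_of_isDedekindDomain.mpr fun Q hQ _ => ?_
    haveI := hQ
    exact hunrAt Q
  exact dvd_classNumber_of_isUnramifiedIn_of_odd_prime_card L E Nat.prime_three (by norm_num)
    hcard hunr

end Summit.QuantumAdvantage.QuantumAdvantage.Theorems.LinnikCubicClassGroups

end
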